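import Summits.QuantumFields.QCD.Theses.NestedDissectionSea
import Summits.QuantumFields.QCD.Theorems.NestedDissectionSeaKineticEdge
import Summits.QuantumFields.QCD.Theorems.NestedDissectionSeaEarlyCrosserLawStubQuasimodeUnionBound
import Literature.MathematicalPhysics.QuantumFieldTheory.QCD
import Summits.QuantumFields.QCD.Theorems.NestedDissectionSeaNegativeCellsDiluteOfPinnedStripLaw

/-!
# Reduction of the crux `EarlyCrosserLaw` (stmt-QuantumFields-13995) to PIN + PSEUDOSPECTRAL COVER LAW
(line `kac-rice-hermitian-dos`, lead prover-line-stmt-QuantumFields-13995-1, 2026-08-16)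

Sorry-free, definition-free companion of the registered skeleton
`Cruxes/EarlyCrosserLaw/Lines/kac_rice_hermitian_dos.lean`.  With the line's deterministic layer LANDED and imported —
the Dirichlet kinetic edge (`Summit.QuantumFields.QCD.Theorems.kineticEdge_proof`, route support `KineticEdge`) and the
union bound for the phase-quenched ratio over quasimode events (`stub_quasimodeUnionBound`, p96614) —
`Summit.QuantumFields.QCD.Theses.NestedDissectionSea.EarlyCrosserLaw` is a kernel-checked consequence of two named
physics statements, taken here as explicit hypotheses whose texts are the registered stub signatures `stub_pinnedLine` /
`stub_coverLaw` verbatim (tree vocabulary only):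
* `dilution_of_coverLaw` — core: at fixed `(reg, b₀, ℓ, m, R)` the COVER CLAUSE (for every window cell a finite cover
  `[μc i ± ηc i]` of the early interval `[m_f(k), -e_X(s)]`, `e_X(s) = Σ_i (1 - cos(π/s_i))`, whose summed quasimode-event
  probabilities over cover points × {parent, 16 children} are `≤ δ_j`) implies clause (a′) of the crux at the same data:
  an early crosser of the parent or a child at `μ'` has `μ' ≤ -e_X(s)` (kinetic edge; children via `halfSides_le` and
  antitone `cos` — `MassWegnerCellIndex.edge_mono`, reused from the NegativeCellsDilute line), lies in a cover interval, and its kernel vector is an EXACT `ηc i`-quasimode of the cell at the cover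
  point (`quasimode_of_det_eq_zero`: the bare mass enters the cell additively), so the cover event of (a′) is inside the
  finite union of quasimode events indexed by `Fin n ⊕ Fin n × (Fin 4 → Bool)`, and the landed union bound closes.
* `EarlyCrosserLaw_of_pinnedLine_of_coverLaw` — FORM A, the registered cut: shared TWO-SIDED PARITY PIN ((b) ∧ (b″) with
  its own `∃ reg … ∃ R`; Yang–Mills topology; the SAME proposition as the acj line's registered `stub_pinnedLine`) + COVER
  LAW asked of EVERY admissible regularisation at every `(M₀, m > M₀ + C, R)` at which both pins hold.
* `EarlyCrosserLaw_of_pinnedCover` — FORM B, the ∃-merged cut: ONE regularisation carrying pins and cover clause at its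
  own line and its own `R` (no uniqueness of the parity jump line imported).
Planners may read either form as the glue of a glued split of the crux (D-0019); compare the acj reduction
`Theorems/NestedDissectionSeaEarlyCrosserLawReduction.lean` (Jensen mean-count transfer behind the same pin).
-/

noncomputable section

open scoped BigOperators Classical
open Matrix Complex Filter MeasureTheory
open Literature.MathematicalPhysics.QuantumLattice Literature.MathematicalPhysics.QuantumFieldTheory
  Literature.Probability.LatticeModels
open Summit.QuantumFields.QCD.Theses.NestedDissectionSea

namespace Summit.QuantumFields.QCD.Cruxes.EarlyCrosserLaw.KacRiceHermitianDos

namespace CoverReduction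

variable {N : ℕ} [NeZero N]

omit [NeZero N] in
/-- The bare mass enters a Dirichlet cell additively: `D_c(μ) = D_c(μ') + (μ - μ')·1`. [folklore] -/
theorem wilsonCell_eq_add_smul_one (U : GaugeConfig 4 N SU3) (μ μ' : ℝ) (x : TorusSite 4 N)
    (s : Fin 4 → ℕ) :
    wilsonCell U μ x s = wilsonCell U μ' x s + (((μ - μ' : ℝ)) : ℂ) • (1 : Matrix _ _ ℂ) := by
  ext p q
  rw [Matrix.add_apply, Matrix.smul_apply, Matrix.one_apply, smul_eq_mul]
  simp only [wilsonCell, Matrix.toSquareBlockProp_def, Matrix.of_apply, wilsonDirac]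
  by_cases h : p = q
  · have h' : (p : TorusSite 4 N × Fin 3 × Fin 4) = q := congrArg Subtype.val h
    rw [if_pos h', if_pos h', if_pos h]
    push_cast
    ring
  · have h' : (p : TorusSite 4 N × Fin 3 × Fin 4) ≠ q := fun h'' => h (Subtype.ext h'')
    rw [if_neg h', if_neg h', if_neg h]
    ring

/-- **Fixed-resolution Kac–Rice (the exact layer of the line).** A crossing of the cell at bare
mass `μ'` (`det D_c(μ') = 0`) yields, at every mass `μ` with `|μ - μ'| ≤ η`, a non-zero `η`-quasimode of
`D_c(μ)` in the Euclidean norm: the kernel vector itself, `D_c(μ) w = (μ - μ') w`. [folklore] -/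
theorem quasimode_of_det_eq_zero (U : GaugeConfig 4 N SU3) {μ' : ℝ} (x : TorusSite 4 N)
    (s : Fin 4 → ℕ) (hdet : (wilsonCell U μ' x s).det = 0) (μ η : ℝ) (hη : |μ - μ'| ≤ η) :
    ∃ w : {p // wilsonBox x s p} → ℂ, w ≠ 0 ∧
      ∑ p, ‖(wilsonCell U μ x s *ᵥ w) p‖ ^ 2 ≤ η ^ 2 * ∑ p, ‖w p‖ ^ 2 := by
  obtain ⟨w, hw0, hw⟩ := Matrix.exists_mulVec_eq_zero_iff.mpr hdet
  refine ⟨w, hw0, ?_⟩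
  have key : wilsonCell U μ x s *ᵥ w = (((μ - μ' : ℝ)) : ℂ) • w := by
    rw [wilsonCell_eq_add_smul_one U μ μ' x s, Matrix.add_mulVec, hw, zero_add,
      Matrix.smul_mulVec, Matrix.one_mulVec]
  have hsum : ∑ p, ‖(wilsonCell U μ x s *ᵥ w) p‖ ^ 2 = |μ - μ'| ^ 2 * ∑ p, ‖w p‖ ^ 2 := by
    rw [key, Finset.mul_sum]
    refine Finset.sum_congr rfl fun p _ => ?_
    rw [Pi.smul_apply, smul_eq_mul, norm_mul, Complex.norm_real, Real.norm_eq_abs, mul_pow]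
  rw [hsum]
  have h0 : 0 ≤ ∑ p, ‖w p‖ ^ 2 := Finset.sum_nonneg fun p _ => by positivity
  exact mul_le_mul_of_nonneg_right (pow_le_pow_left₀ (abs_nonneg _) hη 2) h0

/-- **Dirichlet kinetic edge of a cell** (conjunct (a) of the landed route support `KineticEdge`,
`Summit.QuantumFields.QCD.Theorems.kineticEdge_proof`): a Dirichlet cell of corner `x` and sides `s ≤ N`
singular at bare mass `μ'` has `-μ' ≥ e_X(s) = Σ_i (1 - cos(π / s_i))`. -/
theorem kineticEdge_cell (N : ℕ) [NeZero N] (U : GaugeConfig 4 N SU3) (s : Fin 4 → ℕ) (μ' : ℝ)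
    (x : TorusSite 4 N) (hs : ∀ i, s i ≤ N) (hd : (wilsonCell U μ' x s).det = 0) :
    ∑ i, (1 - Real.cos (Real.pi / s i)) ≤ -μ' :=
  (Summit.QuantumFields.QCD.Theorems.kineticEdge_proof N U s).1 μ' x hs hd

end CoverReduction

open CoverReduction

/-! ## The core: the cover clause at fixed data implies clause (a′) at the same data -/

/-- **Cover clause ⇒ clause (a′)** at fixed `(reg, b₀, ℓ, m, R)` (`b₀ ≥ 2`), same `∀ε ∀ᶠk ∀S` prefix and same `δ`: an
early crosser of the corner-`0` window cell or one of its 16 children at `μ' ≥ m_f(k)` has `μ' ≤ -e_X(s)` (kinetic edge,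
children via `halfSides_le` + `MassWegnerCellIndex.edge_mono`), so `μ'` lies in a cover interval `[μc i ± ηc i]` and the kernel vector
is an `ηc i`-quasimode of that cell at `μc i` (`quasimode_of_det_eq_zero`); the cover event is thus inside the union of
the `n · 17` quasimode events, and the landed union bound `stub_quasimodeUnionBound` (index type
`Fin n ⊕ Fin n × (Fin 4 → Bool)`) bounds the ratio of ANY sub-event `E` by their summed ratios `≤ δ_j`. -/
theorem dilution_of_coverLaw {Nf : ℕ} (reg : QCDRegularisation Nf) (b₀ : ℕ) (hb₀ : 2 ≤ b₀) (ℓ : ℝ)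
    (m : Fin Nf → ℝ) (R : ℝ)
    (hcc :
      ∀ ε : ℝ, 0 < ε → ∀ᶠ k : ℕ in Filter.atTop, ∀ S : ℕ, R ≤ reg.a k * (2 * S + 1) →
        ∃ δ : ℕ → ℝ, (∀ j, 0 ≤ δ j) ∧
          ∑ j ∈ Finset.range (Nat.log 2 (⌊ℓ / reg.a k⌋₊ / b₀) + 1), δ j ≤ ε ∧
          ∀ j < Nat.log 2 (⌊ℓ / reg.a k⌋₊ / b₀) + 1, ∀ s : Fin 4 → ℕ,
            (∀ i, b₀ * 2 ^ j ≤ s i ∧ s i < b₀ * 2 ^ (j + 2) ∧ s i ≤ 2 * S + 1 ∧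
              (s i : ℝ) * reg.a k ≤ ℓ) →
            ∃ n : ℕ, ∃ μc ηc : Fin n → ℝ,
              (∀ f : Fin Nf, ∀ t : ℝ, reg.mcrit k + reg.a k * m f / reg.Zm k ≤ t →
                t ≤ -(∑ i, (1 - Real.cos (Real.pi / s i))) → ∃ i : Fin n, |t - μc i| ≤ ηc i) ∧
              ∑ i : Fin n,
                ((∫ U, (if (∃ w : {p // wilsonBox (0 : TorusSite 4 (2 * S + 1)) s p} → ℂ, w ≠ 0 ∧
                      ∑ p, ‖(wilsonCell U (μc i) 0 s *ᵥ w) p‖ ^ 2 ≤ ηc i ^ 2 * ∑ p, ‖w p‖ ^ 2)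
                      then (1 : ℝ) else 0) *
                    (∏ f, ‖fermionDet (wilsonDirac (fundamentalRep (Fin 3)) U (reg.mcrit k + reg.a k * m f / reg.Zm k) 1)‖)
                  ∂(wilsonMeasure (fundamentalRep (Fin 3)) (reg.β k) : Measure (GaugeConfig 4 (2 * S + 1) SU3))) /
                (∫ U, (∏ f, ‖fermionDet (wilsonDirac (fundamentalRep (Fin 3)) U (reg.mcrit k + reg.a k * m f / reg.Zm k) 1)‖)
                  ∂(wilsonMeasure (fundamentalRep (Fin 3)) (reg.β k) : Measure (GaugeConfig 4 (2 * S + 1) SU3))) +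
                ∑ c : Fin 4 → Bool,
                  (∫ U, (if (∃ w : {p // wilsonBox (halfCorner s c) (halfSides s c) p} → ℂ, w ≠ 0 ∧
                      ∑ p, ‖(wilsonCell U (μc i) (halfCorner s c) (halfSides s c) *ᵥ w) p‖ ^ 2 ≤
                        ηc i ^ 2 * ∑ p, ‖w p‖ ^ 2) then (1 : ℝ) else 0) *
                    (∏ f, ‖fermionDet (wilsonDirac (fundamentalRep (Fin 3)) U (reg.mcrit k + reg.a k * m f / reg.Zm k) 1)‖)
                  ∂(wilsonMeasure (fundamentalRep (Fin 3)) (reg.β k) : Measure (GaugeConfig 4 (2 * S + 1) SU3))) /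
                (∫ U, (∏ f, ‖fermionDet (wilsonDirac (fundamentalRep (Fin 3)) U (reg.mcrit k + reg.a k * m f / reg.Zm k) 1)‖)
                  ∂(wilsonMeasure (fundamentalRep (Fin 3)) (reg.β k) : Measure (GaugeConfig 4 (2 * S + 1) SU3)))) ≤ δ j) :
    ∀ ε : ℝ, 0 < ε → ∀ᶠ k : ℕ in Filter.atTop, ∀ S : ℕ, R ≤ reg.a k * (2 * S + 1) →
      ∃ δ : ℕ → ℝ, (∀ j, 0 ≤ δ j) ∧
        ∑ j ∈ Finset.range (Nat.log 2 (⌊ℓ / reg.a k⌋₊ / b₀) + 1), δ j ≤ ε ∧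
        ∀ j < Nat.log 2 (⌊ℓ / reg.a k⌋₊ / b₀) + 1, ∀ s : Fin 4 → ℕ,
          (∀ i, b₀ * 2 ^ j ≤ s i ∧ s i < b₀ * 2 ^ (j + 2) ∧ s i ≤ 2 * S + 1 ∧
            (s i : ℝ) * reg.a k ≤ ℓ) →
          ∀ E : GaugeConfig 4 (2 * S + 1) SU3 → Prop,
            (∀ U, E U → ∃ f : Fin Nf, ∃ μ' : ℝ, reg.mcrit k + reg.a k * m f / reg.Zm k ≤ μ' ∧
              ((wilsonCell U μ' 0 s).det = 0 ∨
                ∃ c : Fin 4 → Bool, (wilsonCell U μ' (halfCorner s c) (halfSides s c)).det = 0)) →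
            (∫ U, (if E U then (1 : ℝ) else 0) *
                (∏ f, ‖fermionDet (wilsonDirac (fundamentalRep (Fin 3)) U (reg.mcrit k + reg.a k * m f / reg.Zm k) 1)‖)
              ∂(wilsonMeasure (fundamentalRep (Fin 3)) (reg.β k) : Measure (GaugeConfig 4 (2 * S + 1) SU3))) /
            (∫ U, (∏ f, ‖fermionDet (wilsonDirac (fundamentalRep (Fin 3)) U (reg.mcrit k + reg.a k * m f / reg.Zm k) 1)‖)
              ∂(wilsonMeasure (fundamentalRep (Fin 3)) (reg.β k) : Measure (GaugeConfig 4 (2 * S + 1) SU3))) ≤ δ j := by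
  intro ε hε
  filter_upwards [hcc ε hε] with k hk
  intro S hS
  obtain ⟨δ, hδ0, hδs, hcell⟩ := hk S hS
  refine ⟨δ, hδ0, hδs, ?_⟩
  intro j hj s hs E hE
  obtain ⟨n, μc, ηc, hcover, hsum⟩ := hcell j hj s hs
  have hs2 : ∀ i, 2 ≤ s i := fun i =>
    calc 2 = 2 * 1 := rfl
      _ ≤ b₀ * 2 ^ j := Nat.mul_le_mul hb₀ Nat.one_le_two_pow
      _ ≤ s i := (hs i).1
  have hsN : ∀ i, s i ≤ 2 * S + 1 := fun i => (hs i).2.2.1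
  -- index the 17 · n events by `Fin n ⊕ Fin n × (Fin 4 → Bool)` (parent points, child points)
  let x : Fin n ⊕ Fin n × (Fin 4 → Bool) → TorusSite 4 (2 * S + 1) :=
    fun q => Sum.elim (fun _ => (0 : TorusSite 4 (2 * S + 1))) (fun ic => halfCorner s ic.2) q
  let sd : Fin n ⊕ Fin n × (Fin 4 → Bool) → Fin 4 → ℕ :=
    fun q => Sum.elim (fun _ => s) (fun ic => halfSides s ic.2) q
  let μq : Fin n ⊕ Fin n × (Fin 4 → Bool) → ℝ :=
    fun q => Sum.elim (fun i => μc i) (fun ic => μc ic.1) q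
  let ηq : Fin n ⊕ Fin n × (Fin 4 → Bool) → ℝ :=
    fun q => Sum.elim (fun i => ηc i) (fun ic => ηc ic.1) q
  have hEv : ∀ U, E U → ∃ q : Fin n ⊕ Fin n × (Fin 4 → Bool),
      ∃ w : {p // wilsonBox (x q) (sd q) p} → ℂ, w ≠ 0 ∧
        ∑ p, ‖(wilsonCell U (μq q) (x q) (sd q) *ᵥ w) p‖ ^ 2 ≤ ηq q ^ 2 * ∑ p, ‖w p‖ ^ 2 := by
    intro U hU
    obtain ⟨f, μ', hμ', hsing⟩ := hE U hU
    rcases hsing with h | ⟨c, h⟩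
    · have hup : μ' ≤ -(∑ i, (1 - Real.cos (Real.pi / s i))) := by
        have := kineticEdge_cell (2 * S + 1) U s μ' 0 hsN h
        linarith
      obtain ⟨i, hi⟩ := hcover f μ' hμ' hup
      rw [abs_sub_comm] at hi
      exact ⟨Sum.inl i, quasimode_of_det_eq_zero U 0 s h _ _ hi⟩
    · have hup : μ' ≤ -(∑ i, (1 - Real.cos (Real.pi / s i))) := by
        have h1 := kineticEdge_cell (2 * S + 1) U (halfSides s c) μ' (halfCorner s c)
          (fun i => (halfSides_le s c i).trans (hsN i)) h
        have h2 := Summit.QuantumFields.QCD.Cruxes.NegativeCellsDilute.MassWegnerCellIndex.edge_mono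
          (s := s) (s' := halfSides s c)
          (fun i => Summit.QuantumFields.QCD.Cruxes.NegativeCellsDilute.MassWegnerCellIndex.one_le_halfSides
            s hs2 c i) (fun i => halfSides_le s c i)
        linarith
      obtain ⟨i, hi⟩ := hcover f μ' hμ' hup
      rw [abs_sub_comm] at hi
      exact ⟨Sum.inr (i, c), quasimode_of_det_eq_zero U (halfCorner s c) (halfSides s c) h _ _ hi⟩
  have hub := stub_quasimodeUnionBound Nf S (reg.β k) (fun f => reg.mcrit k + reg.a k * m f / reg.Zm k)
    (Fin n ⊕ Fin n × (Fin 4 → Bool)) x sd μq ηq E hEv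
  refine hub.trans (le_of_eq_of_le ?_ hsum)
  rw [Fintype.sum_sum_type, Fintype.sum_prod_type, ← Finset.sum_add_distrib]
  rfl

/-! ## Form A: the registered cut (shared pin + cover law at pinned lines) -/

/-- **The crux from its two physics statements, Form A** (hypothesis texts = the registered stub signatures
`stub_pinnedLine`, `stub_coverLaw` verbatim).  The pin supplies ONE admissible two-sidedly pinned regularisation
`(reg, M₀)`; the cover law, applied to it, supplies `b₀, ℓ, C`; the crux's threshold is re-based to `M₀ + C`; for every
mass tuple the pin's own `R` serves: (b), (b″) are threaded verbatim (monotone in the threshold) and (a′) is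
`dilution_of_coverLaw` applied to the cover clause at that `R`. -/
theorem EarlyCrosserLaw_of_pinnedLine_of_coverLaw
    (hPin : ∀ Nf : ℕ, (Nf = 2 ∨ Nf = 3) → ∃ reg : QCDRegularisation Nf, reg.HasMassScaling ∧
      (reg.scheme 0 0 0).HasAsymptoticScaling ∧ ∃ M₀ : ℝ, 0 ≤ M₀ ∧
      ∀ m : Fin Nf → ℝ, (∀ f, M₀ < m f) → ∃ R : ℝ, 0 < R ∧
        (
        ∀ M : ℝ, M₀ < M → ∀ᶠ k : ℕ in Filter.atTop, ∀ S : ℕ, R ≤ reg.a k * (2 * S + 1) →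
          (1 / 4 : ℝ) ≤
            (∫ U, (if (fermionDet (wilsonDirac (fundamentalRep (Fin 3)) U
                (reg.mcrit k - reg.a k * M / reg.Zm k) 1)).re < 0 then (1 : ℝ) else 0) *
                (∏ f, ‖fermionDet (wilsonDirac (fundamentalRep (Fin 3)) U (reg.mcrit k + reg.a k * m f / reg.Zm k) 1)‖)
              ∂(wilsonMeasure (fundamentalRep (Fin 3)) (reg.β k) : Measure (GaugeConfig 4 (2 * S + 1) SU3))) /
            (∫ U, (∏ f, ‖fermionDet (wilsonDirac (fundamentalRep (Fin 3)) U (reg.mcrit k + reg.a k * m f / reg.Zm k) 1)‖)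
              ∂(wilsonMeasure (fundamentalRep (Fin 3)) (reg.β k) : Measure (GaugeConfig 4 (2 * S + 1) SU3)))) ∧
        (
        ∀ M : ℝ, M₀ < M → ∀ᶠ k : ℕ in Filter.atTop, ∀ S : ℕ, R ≤ reg.a k * (2 * S + 1) →
          reg.a k * (2 * S + 1) ≤ 2 * R →
          (∫ U, (if (fermionDet (wilsonDirac (fundamentalRep (Fin 3)) U
                (reg.mcrit k + reg.a k * M / reg.Zm k) 1)).re < 0 then (1 : ℝ) else 0) *
                (∏ f, ‖fermionDet (wilsonDirac (fundamentalRep (Fin 3)) U (reg.mcrit k + reg.a k * m f / reg.Zm k) 1)‖)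
              ∂(wilsonMeasure (fundamentalRep (Fin 3)) (reg.β k) : Measure (GaugeConfig 4 (2 * S + 1) SU3))) /
            (∫ U, (∏ f, ‖fermionDet (wilsonDirac (fundamentalRep (Fin 3)) U (reg.mcrit k + reg.a k * m f / reg.Zm k) 1)‖)
              ∂(wilsonMeasure (fundamentalRep (Fin 3)) (reg.β k) : Measure (GaugeConfig 4 (2 * S + 1) SU3))) ≤ (1 / 8 : ℝ)))
    (hCov : ∀ Nf : ℕ, (Nf = 2 ∨ Nf = 3) → ∀ reg : QCDRegularisation Nf, reg.HasMassScaling →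
      (reg.scheme 0 0 0).HasAsymptoticScaling →
      ∃ b₀ : ℕ, 2 ≤ b₀ ∧ ∃ ℓ : ℝ, 0 < ℓ ∧ ∃ C : ℝ, 0 ≤ C ∧
      ∀ M₀ : ℝ, 0 ≤ M₀ → ∀ m : Fin Nf → ℝ, (∀ f, M₀ + C < m f) → ∀ R : ℝ, 0 < R →
        (
        ∀ M : ℝ, M₀ < M → ∀ᶠ k : ℕ in Filter.atTop, ∀ S : ℕ, R ≤ reg.a k * (2 * S + 1) →
          (1 / 4 : ℝ) ≤
            (∫ U, (if (fermionDet (wilsonDirac (fundamentalRep (Fin 3)) U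
                (reg.mcrit k - reg.a k * M / reg.Zm k) 1)).re < 0 then (1 : ℝ) else 0) *
                (∏ f, ‖fermionDet (wilsonDirac (fundamentalRep (Fin 3)) U (reg.mcrit k + reg.a k * m f / reg.Zm k) 1)‖)
              ∂(wilsonMeasure (fundamentalRep (Fin 3)) (reg.β k) : Measure (GaugeConfig 4 (2 * S + 1) SU3))) /
            (∫ U, (∏ f, ‖fermionDet (wilsonDirac (fundamentalRep (Fin 3)) U (reg.mcrit k + reg.a k * m f / reg.Zm k) 1)‖)
              ∂(wilsonMeasure (fundamentalRep (Fin 3)) (reg.β k) : Measure (GaugeConfig 4 (2 * S + 1) SU3)))) →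
        (
        ∀ M : ℝ, M₀ < M → ∀ᶠ k : ℕ in Filter.atTop, ∀ S : ℕ, R ≤ reg.a k * (2 * S + 1) →
          reg.a k * (2 * S + 1) ≤ 2 * R →
          (∫ U, (if (fermionDet (wilsonDirac (fundamentalRep (Fin 3)) U
                (reg.mcrit k + reg.a k * M / reg.Zm k) 1)).re < 0 then (1 : ℝ) else 0) *
                (∏ f, ‖fermionDet (wilsonDirac (fundamentalRep (Fin 3)) U (reg.mcrit k + reg.a k * m f / reg.Zm k) 1)‖)
              ∂(wilsonMeasure (fundamentalRep (Fin 3)) (reg.β k) : Measure (GaugeConfig 4 (2 * S + 1) SU3))) /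
            (∫ U, (∏ f, ‖fermionDet (wilsonDirac (fundamentalRep (Fin 3)) U (reg.mcrit k + reg.a k * m f / reg.Zm k) 1)‖)
              ∂(wilsonMeasure (fundamentalRep (Fin 3)) (reg.β k) : Measure (GaugeConfig 4 (2 * S + 1) SU3))) ≤ (1 / 8 : ℝ)) →
        ∀ ε : ℝ, 0 < ε → ∀ᶠ k : ℕ in Filter.atTop, ∀ S : ℕ, R ≤ reg.a k * (2 * S + 1) →
          ∃ δ : ℕ → ℝ, (∀ j, 0 ≤ δ j) ∧
            ∑ j ∈ Finset.range (Nat.log 2 (⌊ℓ / reg.a k⌋₊ / b₀) + 1), δ j ≤ ε ∧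
            ∀ j < Nat.log 2 (⌊ℓ / reg.a k⌋₊ / b₀) + 1, ∀ s : Fin 4 → ℕ,
              (∀ i, b₀ * 2 ^ j ≤ s i ∧ s i < b₀ * 2 ^ (j + 2) ∧ s i ≤ 2 * S + 1 ∧
                (s i : ℝ) * reg.a k ≤ ℓ) →
              ∃ n : ℕ, ∃ μc ηc : Fin n → ℝ,
                (∀ f : Fin Nf, ∀ t : ℝ, reg.mcrit k + reg.a k * m f / reg.Zm k ≤ t →
                  t ≤ -(∑ i, (1 - Real.cos (Real.pi / s i))) → ∃ i : Fin n, |t - μc i| ≤ ηc i) ∧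
                ∑ i : Fin n,
                  ((∫ U, (if (∃ w : {p // wilsonBox (0 : TorusSite 4 (2 * S + 1)) s p} → ℂ, w ≠ 0 ∧
                        ∑ p, ‖(wilsonCell U (μc i) 0 s *ᵥ w) p‖ ^ 2 ≤ ηc i ^ 2 * ∑ p, ‖w p‖ ^ 2)
                        then (1 : ℝ) else 0) *
                      (∏ f, ‖fermionDet (wilsonDirac (fundamentalRep (Fin 3)) U (reg.mcrit k + reg.a k * m f / reg.Zm k) 1)‖)
                    ∂(wilsonMeasure (fundamentalRep (Fin 3)) (reg.β k) : Measure (GaugeConfig 4 (2 * S + 1) SU3))) /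
                  (∫ U, (∏ f, ‖fermionDet (wilsonDirac (fundamentalRep (Fin 3)) U (reg.mcrit k + reg.a k * m f / reg.Zm k) 1)‖)
                    ∂(wilsonMeasure (fundamentalRep (Fin 3)) (reg.β k) : Measure (GaugeConfig 4 (2 * S + 1) SU3))) +
                  ∑ c : Fin 4 → Bool,
                    (∫ U, (if (∃ w : {p // wilsonBox (halfCorner s c) (halfSides s c) p} → ℂ, w ≠ 0 ∧
                        ∑ p, ‖(wilsonCell U (μc i) (halfCorner s c) (halfSides s c) *ᵥ w) p‖ ^ 2 ≤
                          ηc i ^ 2 * ∑ p, ‖w p‖ ^ 2) then (1 : ℝ) else 0) *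
                      (∏ f, ‖fermionDet (wilsonDirac (fundamentalRep (Fin 3)) U (reg.mcrit k + reg.a k * m f / reg.Zm k) 1)‖)
                    ∂(wilsonMeasure (fundamentalRep (Fin 3)) (reg.β k) : Measure (GaugeConfig 4 (2 * S + 1) SU3))) /
                  (∫ U, (∏ f, ‖fermionDet (wilsonDirac (fundamentalRep (Fin 3)) U (reg.mcrit k + reg.a k * m f / reg.Zm k) 1)‖)
                    ∂(wilsonMeasure (fundamentalRep (Fin 3)) (reg.β k) : Measure (GaugeConfig 4 (2 * S + 1) SU3)))) ≤ δ j) :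
    EarlyCrosserLaw := by
  intro Nf hNf
  obtain ⟨reg, hms, has, M₀, hM₀, hpin⟩ := hPin Nf hNf
  obtain ⟨b₀, hb₀, ℓ, hℓ, C, hC, hcov⟩ := hCov Nf hNf reg hms has
  refine ⟨reg, hms, has, M₀ + C, by linarith, b₀, hb₀, ℓ, hℓ, fun m hm => ?_⟩
  have hm₀ : ∀ f, M₀ < m f := fun f => by have := hm f; linarith
  obtain ⟨R, hR, hlow, hup⟩ := hpin m hm₀
  refine ⟨R, hR, ?_, fun M hM => hlow M (by linarith), fun M hM => hup M (by linarith)⟩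
  exact dilution_of_coverLaw reg b₀ hb₀ ℓ m R (hcov M₀ hM₀ m hm R hR hlow hup)

/-! ## Form B: the ∃-merged cut (one regularisation carries pins and cover clause) -/

/-- **The crux from ONE merged physics statement, Form B** (`PinnedCover`: one admissible regularisation, `M₀`, `b₀ ≥ 2`,
`ℓ`, and for every mass tuple above `M₀` one `R` serving (b), (b″) AND the cover clause): the prover of this form may
DEFINE `m_crit(k)` as the parity-jump line and never needs its uniqueness; the crux follows via `dilution_of_coverLaw`. -/
theorem EarlyCrosserLaw_of_pinnedCover
    (h : ∀ Nf : ℕ, (Nf = 2 ∨ Nf = 3) → ∃ reg : QCDRegularisation Nf, reg.HasMassScaling ∧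
      (reg.scheme 0 0 0).HasAsymptoticScaling ∧ ∃ M₀ : ℝ, 0 ≤ M₀ ∧ ∃ b₀ : ℕ, 2 ≤ b₀ ∧ ∃ ℓ : ℝ, 0 < ℓ ∧
      ∀ m : Fin Nf → ℝ, (∀ f, M₀ < m f) → ∃ R : ℝ, 0 < R ∧
        (
        ∀ M : ℝ, M₀ < M → ∀ᶠ k : ℕ in Filter.atTop, ∀ S : ℕ, R ≤ reg.a k * (2 * S + 1) →
          (1 / 4 : ℝ) ≤
            (∫ U, (if (fermionDet (wilsonDirac (fundamentalRep (Fin 3)) U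
                (reg.mcrit k - reg.a k * M / reg.Zm k) 1)).re < 0 then (1 : ℝ) else 0) *
                (∏ f, ‖fermionDet (wilsonDirac (fundamentalRep (Fin 3)) U (reg.mcrit k + reg.a k * m f / reg.Zm k) 1)‖)
              ∂(wilsonMeasure (fundamentalRep (Fin 3)) (reg.β k) : Measure (GaugeConfig 4 (2 * S + 1) SU3))) /
            (∫ U, (∏ f, ‖fermionDet (wilsonDirac (fundamentalRep (Fin 3)) U (reg.mcrit k + reg.a k * m f / reg.Zm k) 1)‖)
              ∂(wilsonMeasure (fundamentalRep (Fin 3)) (reg.β k) : Measure (GaugeConfig 4 (2 * S + 1) SU3)))) ∧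
        (
        ∀ M : ℝ, M₀ < M → ∀ᶠ k : ℕ in Filter.atTop, ∀ S : ℕ, R ≤ reg.a k * (2 * S + 1) →
          reg.a k * (2 * S + 1) ≤ 2 * R →
          (∫ U, (if (fermionDet (wilsonDirac (fundamentalRep (Fin 3)) U
                (reg.mcrit k + reg.a k * M / reg.Zm k) 1)).re < 0 then (1 : ℝ) else 0) *
                (∏ f, ‖fermionDet (wilsonDirac (fundamentalRep (Fin 3)) U (reg.mcrit k + reg.a k * m f / reg.Zm k) 1)‖)
              ∂(wilsonMeasure (fundamentalRep (Fin 3)) (reg.β k) : Measure (GaugeConfig 4 (2 * S + 1) SU3))) /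
            (∫ U, (∏ f, ‖fermionDet (wilsonDirac (fundamentalRep (Fin 3)) U (reg.mcrit k + reg.a k * m f / reg.Zm k) 1)‖)
              ∂(wilsonMeasure (fundamentalRep (Fin 3)) (reg.β k) : Measure (GaugeConfig 4 (2 * S + 1) SU3))) ≤ (1 / 8 : ℝ)) ∧
        (
        ∀ ε : ℝ, 0 < ε → ∀ᶠ k : ℕ in Filter.atTop, ∀ S : ℕ, R ≤ reg.a k * (2 * S + 1) →
          ∃ δ : ℕ → ℝ, (∀ j, 0 ≤ δ j) ∧
            ∑ j ∈ Finset.range (Nat.log 2 (⌊ℓ / reg.a k⌋₊ / b₀) + 1), δ j ≤ ε ∧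
            ∀ j < Nat.log 2 (⌊ℓ / reg.a k⌋₊ / b₀) + 1, ∀ s : Fin 4 → ℕ,
              (∀ i, b₀ * 2 ^ j ≤ s i ∧ s i < b₀ * 2 ^ (j + 2) ∧ s i ≤ 2 * S + 1 ∧
                (s i : ℝ) * reg.a k ≤ ℓ) →
              ∃ n : ℕ, ∃ μc ηc : Fin n → ℝ,
                (∀ f : Fin Nf, ∀ t : ℝ, reg.mcrit k + reg.a k * m f / reg.Zm k ≤ t →
                  t ≤ -(∑ i, (1 - Real.cos (Real.pi / s i))) → ∃ i : Fin n, |t - μc i| ≤ ηc i) ∧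
                ∑ i : Fin n,
                  ((∫ U, (if (∃ w : {p // wilsonBox (0 : TorusSite 4 (2 * S + 1)) s p} → ℂ, w ≠ 0 ∧
                        ∑ p, ‖(wilsonCell U (μc i) 0 s *ᵥ w) p‖ ^ 2 ≤ ηc i ^ 2 * ∑ p, ‖w p‖ ^ 2)
                        then (1 : ℝ) else 0) *
                      (∏ f, ‖fermionDet (wilsonDirac (fundamentalRep (Fin 3)) U (reg.mcrit k + reg.a k * m f / reg.Zm k) 1)‖)
                    ∂(wilsonMeasure (fundamentalRep (Fin 3)) (reg.β k) : Measure (GaugeConfig 4 (2 * S + 1) SU3))) /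
                  (∫ U, (∏ f, ‖fermionDet (wilsonDirac (fundamentalRep (Fin 3)) U (reg.mcrit k + reg.a k * m f / reg.Zm k) 1)‖)
                    ∂(wilsonMeasure (fundamentalRep (Fin 3)) (reg.β k) : Measure (GaugeConfig 4 (2 * S + 1) SU3))) +
                  ∑ c : Fin 4 → Bool,
                    (∫ U, (if (∃ w : {p // wilsonBox (halfCorner s c) (halfSides s c) p} → ℂ, w ≠ 0 ∧
                        ∑ p, ‖(wilsonCell U (μc i) (halfCorner s c) (halfSides s c) *ᵥ w) p‖ ^ 2 ≤
                          ηc i ^ 2 * ∑ p, ‖w p‖ ^ 2) then (1 : ℝ) else 0) *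
                      (∏ f, ‖fermionDet (wilsonDirac (fundamentalRep (Fin 3)) U (reg.mcrit k + reg.a k * m f / reg.Zm k) 1)‖)
                    ∂(wilsonMeasure (fundamentalRep (Fin 3)) (reg.β k) : Measure (GaugeConfig 4 (2 * S + 1) SU3))) /
                  (∫ U, (∏ f, ‖fermionDet (wilsonDirac (fundamentalRep (Fin 3)) U (reg.mcrit k + reg.a k * m f / reg.Zm k) 1)‖)
                    ∂(wilsonMeasure (fundamentalRep (Fin 3)) (reg.β k) : Measure (GaugeConfig 4 (2 * S + 1) SU3)))) ≤ δ j)) :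
    EarlyCrosserLaw := by
  intro Nf hNf
  obtain ⟨reg, hms, has, M₀, hM₀, b₀, hb₀, ℓ, hℓ, hm⟩ := h Nf hNf
  refine ⟨reg, hms, has, M₀, hM₀, b₀, hb₀, ℓ, hℓ, fun m hmm => ?_⟩
  obtain ⟨R, hR, hB, hB2, hC⟩ := hm m hmm
  exact ⟨R, hR, dilution_of_coverLaw reg b₀ hb₀ ℓ m R hC, hB, hB2⟩

end Summit.QuantumFields.QCD.Cruxes.EarlyCrosserLaw.KacRiceHermitianDos

end
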